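import Summits.PneNP.PneNP.Theorems.ChebyshevTracialDesignAPrioriBounds
import HarnessLib

/-!
# Cell pnp-psdrank, route `ChebyshevTracialDesign`: RANGE COMPRESSION — a tight psd strategy may be compressed to the span of the other side's
# ranges without changing a single trace `tr(X_U Y_M)` and without losing tightness or the contraction bounds

Structural normal form for the crux `TracialDecayExp20` (stmt-PneNP-19878), brick 56 (prover g11; MEMO-14 §2(b)–(c), the first step of any
'alignment' analysis of the dense non-crossing psd cell isolated by bricks 51–55). Let `(X, Y)` be a tight-orthogonal psd rectangle of dimension `r`
(`IsPsdRect`) and `P` an orthogonal projection (`Pᵀ = P`, `P² = P`) FIXING THE MATCHING SIDE (`P Y_M = Y_M` for all `M`, e.g. the projection onto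
`Σ_M range(Y_M)`). Then the compressed cut side `X'_U := P X_U P` satisfies:
* `isPsdRect_compress_left` — `(X', Y)` is again a tight-orthogonal psd rectangle (`0 ⪯ PX_UP ⪯ I`; `PX_UP·Y_M = PX_U Y_M = 0` on tight pairs);
* `trace_compress_left_mul` — `tr(X'_U Y_M) = tr(X_U Y_M)` for EVERY pair (so every cell value, every level profile and the design value are unchanged);
* `trace_compress_left_le` — `tr X'_U ≤ tr X_U` (trace densities can only drop);
* `value_compress_left_eq` — `Σ_U Σ_M W(U,M)·tr(X'_U Y_M) = Σ_U Σ_M W(U,M)·tr(X_U Y_M)` for every weight `W`;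
and symmetrically `isPsdRect_compress_right` etc. for a projection fixing the cut side. Consequence (normal form, by alternating the two
compressions until the dimensions of `Σ_U range X_U` and `Σ_M range Y_M` stabilise): in the crux, and in the dense cell of bricks 54/55, one may
assume `Σ_U range(X_U) = Σ_M range(Y_M)` — GLOBAL misalignment by disjoint ranges (the `X_U = x_U P`, `Y_M = y_M P^⊥` examples of MEMO-12 §2)
never carries value; what tightness then says is the local statement `range(X_U) ⊥ Σ_{M tight with U} range(Y_M) ⊊ Σ_M range(Y_M)` (brick 40).
[cite: BrietDadushPokutta2014, Thm. 6 (§3)] [cite: GriblingDelaatLaurent2019, §5]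
Stature: support/instrument (no defs). WHAT THIS IS NOT: no estimate, nothing on the dense cell itself, nothing on psd rank, no P-vs-NP content.
Supports stmt-PneNP-19878.
-/

set_option linter.dupNamespace false -- `Summit.PneNP.PneNP.…`: summit = sub-problem (D-0017)

noncomputable section

namespace Summit.PneNP.PneNP.Theorems.ChebyshevTracialDesignRangeCompression

open Finset Matrix Literature.Barriers.PneNP Literature.Combinatorics.Optimization
open Summit.PneNP.PneNP.Theorems.ChebyshevTracialDesignAPrioriBounds (trace_mul_le_trace_left trace_mul_le_trace_right)

variable {n r : ℕ}

/-! ### §1 Orthogonal projections as real matrices -/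

/-- For a real symmetric idempotent `P`, `1 − P` is psd (`1 − P = (1 − P)(1 − P)ᵀ`). [folklore] -/
theorem posSemidef_one_sub_proj {P : Matrix (Fin r) (Fin r) ℝ} (hPs : Pᵀ = P) (hPi : P * P = P) : (1 - P).PosSemidef := by
  have h : (1 - P) * (1 - P)ᴴ = 1 - P := by
    rw [conjTranspose_eq_transpose_of_trivial, transpose_sub, transpose_one, hPs, sub_mul, mul_sub, mul_sub, one_mul, mul_one,
      one_mul, hPi]
    abel
  rw [← h]
  exact posSemidef_self_mul_conjTranspose _

/-- For a real symmetric idempotent `P`, `P` is psd (`P = P Pᵀ`). [folklore] -/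
theorem posSemidef_proj {P : Matrix (Fin r) (Fin r) ℝ} (hPs : Pᵀ = P) (hPi : P * P = P) : P.PosSemidef := by
  have h : P * Pᴴ = P := by rw [conjTranspose_eq_transpose_of_trivial, hPs, hPi]
  rw [← h]
  exact posSemidef_self_mul_conjTranspose _

/-- A psd real matrix is symmetric. [folklore] -/
theorem transpose_eq_of_posSemidef {A : Matrix (Fin r) (Fin r) ℝ} (hA : A.PosSemidef) : Aᵀ = A := by
  have h := hA.1
  rw [IsHermitian, conjTranspose_eq_transpose_of_trivial] at h
  exact h

/-- If a projection fixes a symmetric matrix from the left it fixes it from the right: `P Y = Y ⇒ Y P = Y`. [folklore] -/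
theorem mul_proj_eq_of_proj_mul_eq {P Y : Matrix (Fin r) (Fin r) ℝ} (hPs : Pᵀ = P) (hYs : Yᵀ = Y) (h : P * Y = Y) : Y * P = Y := by
  have := congrArg transpose h
  rwa [transpose_mul, hPs, hYs] at this

/-! ### §2 Compressing the cut side -/

/-- **Compression keeps the contraction bounds**: `0 ⪯ P X P ⪯ I` for `0 ⪯ X ⪯ I` and an orthogonal projection `P`
(`1 − PXP = (1 − P) + P(1 − X)P`). [cite: BrietDadushPokutta2014, Thm. 6 (§3)] -/
theorem compress_contraction {P X : Matrix (Fin r) (Fin r) ℝ} (hPs : Pᵀ = P) (hPi : P * P = P)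
    (hX : X.PosSemidef ∧ (1 - X).PosSemidef) : (P * X * P).PosSemidef ∧ (1 - P * X * P).PosSemidef := by
  have hPH : Pᴴ = P := by rw [conjTranspose_eq_transpose_of_trivial, hPs]
  refine ⟨?_, ?_⟩
  · have := hX.1.mul_mul_conjTranspose_same P
    rwa [hPH] at this
  · have h1 : (P * (1 - X) * P).PosSemidef := by
      have := hX.2.mul_mul_conjTranspose_same P
      rwa [hPH] at this
    have h2 : 1 - P * X * P = (1 - P) + P * (1 - X) * P := by
      rw [mul_sub, sub_mul, mul_one, hPi]; abel
    rw [h2]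
    exact (posSemidef_one_sub_proj hPs hPi).add h1

/-- **Compressing the cut side to a projection fixing the matching side keeps a tight-orthogonal psd rectangle tight-orthogonal and psd.**
For `(X, Y)` with `IsPsdRect X Y` and an orthogonal projection `P` with `P Y_M = Y_M` for all `M`: `IsPsdRect (U ↦ P X_U P) Y`.
[cite: BrietDadushPokutta2014, Thm. 6 (§3)] -/
theorem isPsdRect_compress_left {X : OddSet n → Matrix (Fin r) (Fin r) ℝ} {Y : PMatch n → Matrix (Fin r) (Fin r) ℝ} (hXY : IsPsdRect X Y)
    {P : Matrix (Fin r) (Fin r) ℝ} (hPs : Pᵀ = P) (hPi : P * P = P) (hPY : ∀ M, P * Y M = Y M) :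
    IsPsdRect (fun U => P * X U * P) Y := by
  refine ⟨fun U => compress_contraction hPs hPi (hXY.1 U), hXY.2.1, fun U M hcc => ?_⟩
  show P * X U * P * Y M = 0
  rw [Matrix.mul_assoc, hPY M, Matrix.mul_assoc, hXY.2.2 U M hcc, Matrix.mul_zero]

/-- **Compression does not change a single trace**: `tr((P X P) Y) = tr(X Y)` whenever `P Y = Y` (`Y` symmetric, `P` an orthogonal projection).
[cite: GriblingDelaatLaurent2019, §5] -/
theorem trace_compress_left_mul {P X Y : Matrix (Fin r) (Fin r) ℝ} (hPs : Pᵀ = P) (hYs : Yᵀ = Y) (hPY : P * Y = Y) :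
    (P * X * P * Y).trace = (X * Y).trace := by
  have hYP : Y * P = Y := mul_proj_eq_of_proj_mul_eq hPs hYs hPY
  calc (P * X * P * Y).trace = (P * X * Y).trace := by rw [Matrix.mul_assoc (P * X) P Y, hPY]
    _ = (X * Y * P).trace := by rw [Matrix.mul_assoc P X Y, trace_mul_comm]
    _ = (X * Y).trace := by rw [Matrix.mul_assoc X Y P, hYP]

/-- **Compression can only lower the trace**: `tr(P X P) = tr(X P) ≤ tr X` for `X ⪰ 0` and an orthogonal projection `P`.
[cite: BrietDadushPokutta2014, Thm. 6 (§3)] -/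
theorem trace_compress_left_le {P X : Matrix (Fin r) (Fin r) ℝ} (hPs : Pᵀ = P) (hPi : P * P = P) (hX : X.PosSemidef) :
    (P * X * P).trace ≤ X.trace := by
  calc (P * X * P).trace = (P * (P * X)).trace := trace_mul_comm _ _
    _ = (P * P * X).trace := by rw [Matrix.mul_assoc]
    _ = (X * (P * P)).trace := trace_mul_comm _ _
    _ = (X * P).trace := by rw [hPi]
    _ ≤ X.trace := trace_mul_le_trace_left hX (posSemidef_one_sub_proj hPs hPi)

/-- **The design value (indeed every weighted value) is invariant under compression of the cut side.** For any weight `W`, a tight-orthogonal psd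
rectangle `(X, Y)` and an orthogonal projection `P` fixing every `Y_M`: `Σ_U Σ_M W(U,M)·tr((PX_UP) Y_M) = Σ_U Σ_M W(U,M)·tr(X_U Y_M)`.
[cite: GriblingDelaatLaurent2019, §5] -/
theorem value_compress_left_eq (W : OddSet n → PMatch n → ℝ) {X : OddSet n → Matrix (Fin r) (Fin r) ℝ}
    {Y : PMatch n → Matrix (Fin r) (Fin r) ℝ} (hXY : IsPsdRect X Y) {P : Matrix (Fin r) (Fin r) ℝ} (hPs : Pᵀ = P)
    (hPY : ∀ M, P * Y M = Y M) :
    ∑ U, ∑ M, W U M * (P * X U * P * Y M).trace = ∑ U, ∑ M, W U M * (X U * Y M).trace :=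
  sum_congr rfl fun U _ => sum_congr rfl fun M _ => by
    rw [trace_compress_left_mul hPs (transpose_eq_of_posSemidef (hXY.2.1 M).1) (hPY M)]

/-- Hence `TracialValueLEAt` bounds proved for compressed strategies transfer: if the weighted value of `(PXP, Y)` is `≤ γ·r` then so is that of
`(X, Y)` (same number). Stated as the equality of the two normalised values. [cite: GriblingDelaatLaurent2019, §5] -/
theorem value_div_compress_left_eq (W : OddSet n → PMatch n → ℝ) {X : OddSet n → Matrix (Fin r) (Fin r) ℝ}
    {Y : PMatch n → Matrix (Fin r) (Fin r) ℝ} (hXY : IsPsdRect X Y) {P : Matrix (Fin r) (Fin r) ℝ} (hPs : Pᵀ = P)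
    (hPY : ∀ M, P * Y M = Y M) :
    (∑ U, ∑ M, W U M * (P * X U * P * Y M).trace) / r = (∑ U, ∑ M, W U M * (X U * Y M).trace) / r := by
  rw [value_compress_left_eq W hXY hPs hPY]

/-! ### §3 Compressing the matching side -/

/-- **Compressing the matching side to a projection fixing the cut side** keeps `IsPsdRect`: for `P X_U = X_U` (all `U`), `IsPsdRect X (M ↦ P Y_M P)`
(`X_U·PY_MP = X_UP·Y_MP = X_U Y_M P = 0` on tight pairs, using `X_U P = X_U`). [cite: BrietDadushPokutta2014, Thm. 6 (§3)] -/
theorem isPsdRect_compress_right {X : OddSet n → Matrix (Fin r) (Fin r) ℝ} {Y : PMatch n → Matrix (Fin r) (Fin r) ℝ} (hXY : IsPsdRect X Y)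
    {P : Matrix (Fin r) (Fin r) ℝ} (hPs : Pᵀ = P) (hPi : P * P = P) (hPX : ∀ U, P * X U = X U) :
    IsPsdRect X (fun M => P * Y M * P) := by
  refine ⟨hXY.1, fun M => compress_contraction hPs hPi (hXY.2.1 M), fun U M hcc => ?_⟩
  have hXP : X U * P = X U := mul_proj_eq_of_proj_mul_eq hPs (transpose_eq_of_posSemidef (hXY.1 U).1) (hPX U)
  show X U * (P * Y M * P) = 0
  rw [← Matrix.mul_assoc, ← Matrix.mul_assoc, hXP, hXY.2.2 U M hcc, Matrix.zero_mul]

/-- `tr(X (P Y P)) = tr(X Y)` whenever `P X = X` (`X` symmetric, `P` an orthogonal projection). [cite: GriblingDelaatLaurent2019, §5] -/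
theorem trace_compress_right_mul {P X Y : Matrix (Fin r) (Fin r) ℝ} (hPs : Pᵀ = P) (hXs : Xᵀ = X) (hPX : P * X = X) :
    (X * (P * Y * P)).trace = (X * Y).trace := by
  have hXP : X * P = X := mul_proj_eq_of_proj_mul_eq hPs hXs hPX
  calc (X * (P * Y * P)).trace = (X * Y * P).trace := by rw [← Matrix.mul_assoc X (P * Y) P, ← Matrix.mul_assoc X P Y, hXP]
    _ = (P * (X * Y)).trace := trace_mul_comm _ _
    _ = (X * Y).trace := by rw [← Matrix.mul_assoc, hPX]

/-- `tr(P Y P) ≤ tr Y` for `Y ⪰ 0`. [cite: BrietDadushPokutta2014, Thm. 6 (§3)] -/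
theorem trace_compress_right_le {P Y : Matrix (Fin r) (Fin r) ℝ} (hPs : Pᵀ = P) (hPi : P * P = P) (hY : Y.PosSemidef) :
    (P * Y * P).trace ≤ Y.trace :=
  trace_compress_left_le hPs hPi hY

/-- The weighted value is invariant under compression of the matching side. [cite: GriblingDelaatLaurent2019, §5] -/
theorem value_compress_right_eq (W : OddSet n → PMatch n → ℝ) {X : OddSet n → Matrix (Fin r) (Fin r) ℝ}
    {Y : PMatch n → Matrix (Fin r) (Fin r) ℝ} (hXY : IsPsdRect X Y) {P : Matrix (Fin r) (Fin r) ℝ} (hPs : Pᵀ = P)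
    (hPX : ∀ U, P * X U = X U) :
    ∑ U, ∑ M, W U M * (X U * (P * Y M * P)).trace = ∑ U, ∑ M, W U M * (X U * Y M).trace :=
  sum_congr rfl fun U _ => sum_congr rfl fun M _ => by
    rw [trace_compress_right_mul hPs (transpose_eq_of_posSemidef (hXY.1 U).1) (hPX U)]

end Summit.PneNP.PneNP.Theorems.ChebyshevTracialDesignRangeCompression
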